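import Summits.QuantumFields.YangMills.Theorems.TubeZeroFreeChannel.Negative.KillCriteria

/-!
# `TubeZeroFreeChannel` is a statement about ONE closed planar set: the cofinal accumulation points of tube zeros

Support file for the crux `stmt-QuantumFields-18841` (`ComplexCouplingChannel.TubeZeroFreeChannel`), line lead a3.
For an admissible pair `(G, r)` let `A(G, r) ⊂ ℂ` be the set of COFINAL ACCUMULATION POINTS of zeros of the box
partition functions `boxZ r · L t` (cofinal in the cross-section `L`, then in the length `t`; the frontier clause of
`Negative.not_tubeZeroFreeChannel_of_sealedWall`, spelled out in every hypothesis below — no definitions):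
`z ∈ A ⟺ ∀ ε > 0, ∀ L₀, ∃ L ≥ L₀, ∀ t₀, ∃ t ≥ t₀, ∃ w, dist w z < ε ∧ boxZ r w L t = 0`.

Main result `tubeZeroFreeChannel_iff_joinedIn`: **the crux holds iff for every admissible `(G, r)` there is `β₁`
such that every real `β ≥ β₁` is joined, for every `ρ > 0`, to some real `x` with `|x| < ρ` by a path in `ℂ ∖ A(G, r)`.**
So the crux — uniform zero-freeness (`∃ L₀ ∀ L ≥ L₀ ∃ t₀ ∀ t ≥ t₀`) of SOME open connected set — is exactly the
planar-topological statement "the closed set `A(G, r)` does not cut the large real couplings off from the small ones";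
refuting it at `(G, r)` means exhibiting, for cofinally many `β`, either `β ∈ A` (axis pinch) or a separation of `β`
from the anchor by `A` (wall / moat / sealed pocket), and proving it means joining `β` to the anchor disc avoiding `A`.

Ingredients (all proved here): `exists_mem_forall_dist_lt_of_cofinal` (Bolzano–Weierstrass in the form used twice),
`acc_isClosed` (the accumulation set is closed), `zeroFree_of_closure_forall_not_acc` (a BOUNDED open set whose closure
misses `A` is uniformly zero-free — the converse of the landed `not_zeroFree_of_accPt`), and the construction of a
channel as the connected component of a thickened path (`exists_channel_of_joinedIn`).
-/

noncomputable section

open Filter Set Metric Topology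
open Literature.MathematicalPhysics.QuantumFieldTheory
open Summit.QuantumFields.YangMills.Theses.ComplexCouplingChannel (TubeZeroFreeChannel)
open Summit.QuantumFields.YangMills.Theorems.TubeZeroFreeChannel.Negative

namespace Summit.QuantumFields.YangMills.Theorems.TubeZeroFreeChannel

variable {G : Type} [Group G] [TopologicalSpace G] [IsTopologicalGroup G] [CompactSpace G]
  [MeasurableSpace G] [BorelSpace G]

/-- **Bolzano–Weierstrass, cofinal form.** If for cofinally many `n` the property `P n` has a witness in the
compact set `K`, then some `a ∈ K` is approximated, for cofinally many `n`, by witnesses of `P n`. [folklore] -/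
theorem exists_mem_forall_dist_lt_of_cofinal {K : Set ℂ} (hK : IsCompact K) {P : ℕ → ℂ → Prop}
    (h : ∀ n₀ : ℕ, ∃ n : ℕ, n₀ ≤ n ∧ ∃ u ∈ K, P n u) :
    ∃ a ∈ K, ∀ ε : ℝ, 0 < ε → ∀ n₀ : ℕ, ∃ n : ℕ, n₀ ≤ n ∧ ∃ u : ℂ, P n u ∧ dist u a < ε := by
  choose n hn u hu hP using h
  obtain ⟨a, ha, φ, hφ, hlim⟩ := hK.tendsto_subseq hu
  refine ⟨a, ha, fun ε hε n₀ => ?_⟩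
  obtain ⟨k₀, hk₀⟩ := Metric.tendsto_atTop.1 hlim ε hε
  refine ⟨n (φ (max k₀ n₀)), ?_, u (φ (max k₀ n₀)), hP _, hk₀ _ (le_max_left _ _)⟩
  exact (le_max_right k₀ n₀).trans ((hφ.id_le _).trans (hn _))

/-- A limit of cofinal accumulation points of tube zeros is one. [folklore] -/
theorem acc_of_tendsto (r : LatticeRep G) {z : ℂ} {s : ℕ → ℂ} (hs : Tendsto s atTop (𝓝 z))
    (hacc : ∀ n, ∀ ε : ℝ, 0 < ε → ∀ L₀ : ℕ, ∃ L : ℕ, L₀ ≤ L ∧ ∀ t₀ : ℕ, ∃ t : ℕ, t₀ ≤ t ∧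
      ∃ w : ℂ, dist w (s n) < ε ∧ boxZ r w L t = 0) :
    ∀ ε : ℝ, 0 < ε → ∀ L₀ : ℕ, ∃ L : ℕ, L₀ ≤ L ∧ ∀ t₀ : ℕ, ∃ t : ℕ, t₀ ≤ t ∧
      ∃ w : ℂ, dist w z < ε ∧ boxZ r w L t = 0 := by
  intro ε hε L₀
  have hε2 : 0 < ε / 2 := by linarith
  obtain ⟨n, hn⟩ := Metric.tendsto_atTop.1 hs (ε / 2) hε2
  obtain ⟨L, hL, hLt⟩ := hacc n (ε / 2) hε2 L₀
  refine ⟨L, hL, fun t₀ => ?_⟩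
  obtain ⟨t, ht, w, hw, hZ⟩ := hLt t₀
  refine ⟨t, ht, w, ?_, hZ⟩
  calc dist w z ≤ dist w (s n) + dist (s n) z := dist_triangle _ _ _
    _ < ε / 2 + ε / 2 := add_lt_add hw (hn n le_rfl)
    _ = ε := by ring

/-- **The accumulation set is closed.** [folklore] -/
theorem acc_isClosed (r : LatticeRep G) :
    IsClosed {z : ℂ | ∀ ε : ℝ, 0 < ε → ∀ L₀ : ℕ, ∃ L : ℕ, L₀ ≤ L ∧ ∀ t₀ : ℕ, ∃ t : ℕ, t₀ ≤ t ∧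
      ∃ w : ℂ, dist w z < ε ∧ boxZ r w L t = 0} := by
  refine isClosed_of_closure_subset fun z hz => ?_
  obtain ⟨s, hs, hlim⟩ := mem_closure_iff_seq_limit.1 hz
  exact acc_of_tendsto r hlim fun n => hs n

/-- **A bounded open set whose closure contains no accumulation point is uniformly zero-free** (the converse of
`Negative.not_zeroFree_of_accPt`; two Bolzano–Weierstrass passes: zeros `z_{L,t}` cofinal in `t` accumulate at some
`a_L ∈ closure D`, and the `a_L`, cofinal in `L`, accumulate at an accumulation point). [folklore] -/
theorem zeroFree_of_closure_forall_not_acc (r : LatticeRep G) {D : Set ℂ} (hDb : Bornology.IsBounded D)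
    (hA : ∀ a ∈ closure D, ¬ ∀ ε : ℝ, 0 < ε → ∀ L₀ : ℕ, ∃ L : ℕ, L₀ ≤ L ∧ ∀ t₀ : ℕ, ∃ t : ℕ, t₀ ≤ t ∧
      ∃ w : ℂ, dist w a < ε ∧ boxZ r w L t = 0) :
    ∃ L₀ : ℕ, ∀ L : ℕ, L₀ ≤ L → ∃ t₀ : ℕ, ∀ t : ℕ, t₀ ≤ t → ∀ z ∈ D, boxZ r z L t ≠ 0 := by
  by_contra h
  push Not at h
  have hK : IsCompact (closure D) := hDb.isCompact_closure
  -- pass 1: for every `L` with cofinally many zero-carrying lengths, an accumulation point `a_L` of its zeros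
  have pass1 : ∀ L : ℕ, (∀ t₀ : ℕ, ∃ t : ℕ, t₀ ≤ t ∧ ∃ z ∈ D, boxZ r z L t = 0) →
      ∃ a ∈ closure D, ∀ ε : ℝ, 0 < ε → ∀ t₀ : ℕ, ∃ t : ℕ, t₀ ≤ t ∧
        ∃ u : ℂ, boxZ r u L t = 0 ∧ dist u a < ε := by
    intro L hL
    refine exists_mem_forall_dist_lt_of_cofinal hK (P := fun t u => boxZ r u L t = 0) fun t₀ => ?_
    obtain ⟨t, ht, z, hzD, hz⟩ := hL t₀
    exact ⟨t, ht, z, subset_closure hzD, hz⟩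
  -- pass 2: the `a_L`, cofinal in `L`, accumulate at some `a ∈ closure D`
  obtain ⟨a, ha, hacc⟩ := exists_mem_forall_dist_lt_of_cofinal hK
    (P := fun L a' => ∀ ε : ℝ, 0 < ε → ∀ t₀ : ℕ, ∃ t : ℕ, t₀ ≤ t ∧
      ∃ u : ℂ, boxZ r u L t = 0 ∧ dist u a' < ε) (fun L₀ => by
      obtain ⟨L, hL, hLt⟩ := h L₀
      obtain ⟨a', ha', hP⟩ := pass1 L hLt
      exact ⟨L, hL, a', ha', hP⟩)
  -- `a` is an accumulation point: contradiction
  refine hA a ha fun ε hε L₀ => ?_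
  have hε2 : 0 < ε / 2 := by linarith
  obtain ⟨L, hL, a', hP, ha'⟩ := hacc (ε / 2) hε2 L₀
  refine ⟨L, hL, fun t₀ => ?_⟩
  obtain ⟨t, ht, u, hu, hua⟩ := hP (ε / 2) hε2 t₀
  refine ⟨t, ht, u, ?_, hu⟩
  calc dist u a ≤ dist u a' + dist a' a := dist_triangle _ _ _
    _ < ε / 2 + ε / 2 := add_lt_add hua ha'
    _ = ε := by ring

/-- **A path avoiding the accumulation set thickens to a channel.** If `x` and `y` are joined by a path missing
the accumulation set of `(G, r)`, there is a bounded open connected `D ∋ x, y` that is uniformly zero-free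
(the connected component of `x` in a thickening of the path whose closed thickening still misses the closed set
`A`). [folklore] -/
theorem exists_channel_of_joinedIn (r : LatticeRep G) {x y : ℂ}
    (hJ : JoinedIn {z : ℂ | ¬ ∀ ε : ℝ, 0 < ε → ∀ L₀ : ℕ, ∃ L : ℕ, L₀ ≤ L ∧ ∀ t₀ : ℕ, ∃ t : ℕ, t₀ ≤ t ∧
      ∃ w : ℂ, dist w z < ε ∧ boxZ r w L t = 0} x y) :
    ∃ D : Set ℂ, IsOpen D ∧ IsConnected D ∧ x ∈ D ∧ y ∈ D ∧
      ∃ L₀ : ℕ, ∀ L : ℕ, L₀ ≤ L → ∃ t₀ : ℕ, ∀ t : ℕ, t₀ ≤ t → ∀ z ∈ D, boxZ r z L t ≠ 0 := by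
  set O : Set ℂ := {z : ℂ | ¬ ∀ ε : ℝ, 0 < ε → ∀ L₀ : ℕ, ∃ L : ℕ, L₀ ≤ L ∧ ∀ t₀ : ℕ, ∃ t : ℕ, t₀ ≤ t ∧
      ∃ w : ℂ, dist w z < ε ∧ boxZ r w L t = 0} with hO
  have hOo : IsOpen O := by
    rw [hO]
    exact (acc_isClosed r).isOpen_compl
  obtain ⟨γ, hγ⟩ := hJ
  set K : Set ℂ := range γ with hK
  have hKc : IsCompact K := isCompact_range γ.continuous
  have hKO : K ⊆ O := by rintro _ ⟨s, rfl⟩; exact hγ s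
  obtain ⟨δ, hδ, hδO⟩ := hKc.exists_cthickening_subset_open hOo hKO
  set W : Set ℂ := thickening δ K with hW
  have hWo : IsOpen W := isOpen_thickening
  have hKW : K ⊆ W := self_subset_thickening hδ K
  have hxK : x ∈ K := ⟨0, γ.source⟩
  have hyK : y ∈ K := ⟨1, γ.target⟩
  set D : Set ℂ := connectedComponentIn W x with hD
  have hDW : D ⊆ W := connectedComponentIn_subset W x
  have hKD : K ⊆ D :=
    (isConnected_range γ.continuous).isPreconnected.subset_connectedComponentIn hxK hKW
  refine ⟨D, hWo.connectedComponentIn, isConnected_connectedComponentIn_iff.2 (hKW hxK), hKD hxK, hKD hyK, ?_⟩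
  refine zeroFree_of_closure_forall_not_acc r ((hKc.isBounded.thickening).subset hDW) fun a ha => ?_
  have haO : a ∈ O :=
    hδO ((closure_mono hDW).trans (closure_thickening_subset_cthickening δ K) ha)
  simpa only [hO, mem_setOf_eq] using haO

/-- **`TubeZeroFreeChannel` ⟺ large couplings are joined to the anchor avoiding the accumulation set.** For every
admissible `(G, r)`: there is `β₁` such that for all `β ≥ β₁` and `ρ > 0` some real `x`, `|x| < ρ`, is joined to `β` by
a path none of whose points is a cofinal accumulation point of tube zeros. (`→`: the crux's open connected uniformly
zero-free `D` contains no accumulation point, `Negative.not_zeroFree_of_accPt`, and is path connected;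
`←`: `exists_channel_of_joinedIn`.) [folklore] -/
theorem tubeZeroFreeChannel_iff_joinedIn : TubeZeroFreeChannel ↔
    ∀ (G : Type) [Group G] [TopologicalSpace G] [IsTopologicalGroup G] [CompactSpace G]
      [MeasurableSpace G] [BorelSpace G], IsCompactSimpleLieGroup G → ∀ r : LatticeRep G,
      ∃ β₁ : ℝ, ∀ β : ℝ, β₁ ≤ β → ∀ ρ : ℝ, 0 < ρ → ∃ x : ℝ, |x| < ρ ∧
        JoinedIn {z : ℂ | ¬ ∀ ε : ℝ, 0 < ε → ∀ L₀ : ℕ, ∃ L : ℕ, L₀ ≤ L ∧ ∀ t₀ : ℕ, ∃ t : ℕ, t₀ ≤ t ∧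
          ∃ w : ℂ, dist w z < ε ∧ boxZ r w L t = 0} (x : ℂ) (β : ℂ) := by
  rw [tubeZeroFreeChannel_iff_boxZ]
  constructor
  · intro h G _ _ _ _ _ _ hG r
    obtain ⟨β₁, hβ₁⟩ := h G hG r
    refine ⟨β₁, fun β hβ ρ hρ => ?_⟩
    obtain ⟨D, hDo, hDc, hβD, ⟨x, hxρ, hxD⟩, hzf⟩ := hβ₁ β hβ ρ hρ
    refine ⟨x, hxρ, ?_⟩
    have hDsub : D ⊆ {z : ℂ | ¬ ∀ ε : ℝ, 0 < ε → ∀ L₀ : ℕ, ∃ L : ℕ, L₀ ≤ L ∧ ∀ t₀ : ℕ, ∃ t : ℕ,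
        t₀ ≤ t ∧ ∃ w : ℂ, dist w z < ε ∧ boxZ r w L t = 0} :=
      fun z hz hacc => not_zeroFree_of_accPt r hDo hz hacc hzf
    exact ((hDo.isConnected_iff_isPathConnected.1 hDc).joinedIn _ hxD _ hβD).mono hDsub
  · intro h G _ _ _ _ _ _ hG r
    obtain ⟨β₁, hβ₁⟩ := h G hG r
    refine ⟨β₁, fun β hβ ρ hρ => ?_⟩
    obtain ⟨x, hxρ, hJ⟩ := hβ₁ β hβ ρ hρ
    obtain ⟨D, hDo, hDc, hxD, hβD, hzf⟩ := exists_channel_of_joinedIn r hJ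
    exact ⟨D, hDo, hDc, hβD, ⟨x, hxρ, hxD⟩, hzf⟩

/-- **Refutation shape, necessary AND sufficient.** `¬ TubeZeroFreeChannel` iff at some admissible `(G, r)`, for
cofinally many real `β` and some `ρ > 0`, NO real `x` with `|x| < ρ` is joined to `β` avoiding the accumulation set —
i.e. `β` is itself an accumulation point or the closed set `A(G, r)` separates `β` from all such `x`
(so `Negative.not_tubeZeroFreeChannel_of_blockedChannels` / `_of_sealedWall` lose nothing). [folklore] -/
theorem not_tubeZeroFreeChannel_iff_not_joinedIn : ¬ TubeZeroFreeChannel ↔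
    ∃ (G : Type) (_ : Group G) (_ : TopologicalSpace G) (_ : IsTopologicalGroup G) (_ : CompactSpace G)
      (_ : MeasurableSpace G) (_ : BorelSpace G), IsCompactSimpleLieGroup G ∧ ∃ r : LatticeRep G,
      ∀ β₁ : ℝ, ∃ β : ℝ, β₁ ≤ β ∧ ∃ ρ : ℝ, 0 < ρ ∧ ∀ x : ℝ, |x| < ρ →
        ¬ JoinedIn {z : ℂ | ¬ ∀ ε : ℝ, 0 < ε → ∀ L₀ : ℕ, ∃ L : ℕ, L₀ ≤ L ∧ ∀ t₀ : ℕ, ∃ t : ℕ, t₀ ≤ t ∧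
          ∃ w : ℂ, dist w z < ε ∧ boxZ r w L t = 0} (x : ℂ) (β : ℂ) := by
  rw [tubeZeroFreeChannel_iff_joinedIn]
  constructor
  · intro h
    by_contra hne
    refine h fun G _ _ _ _ _ _ hG r => ?_
    by_contra hr
    refine hne ⟨G, ‹_›, ‹_›, ‹_›, ‹_›, ‹_›, ‹_›, hG, r, fun β₁ => ?_⟩
    by_contra hβ'
    refine hr ⟨β₁, fun β hβ ρ hρ => ?_⟩
    by_contra hx
    exact hβ' ⟨β, hβ, ρ, hρ, fun x hxρ hJ => hx ⟨x, hxρ, hJ⟩⟩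
  · rintro ⟨G, _, _, _, _, _, _, hG, r, hr⟩ h
    obtain ⟨β₁, hβ₁⟩ := h G hG r
    obtain ⟨β, hβ, ρ, hρ, hx⟩ := hr β₁
    obtain ⟨x, hxρ, hJ⟩ := hβ₁ β hβ ρ hρ
    exact hx x hxρ hJ

end Summit.QuantumFields.YangMills.Theorems.TubeZeroFreeChannel
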